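import Summits.QuantumFields.YangMills.Theorems.UnitScaleTiltProp7RLegsCovScalar
import HarnessLib

/-!
# `UnitScaleTiltProp7RLegsCovScalarB` — LANE II (R-LEGS), (K2-S′): THE SCALAR KNIT OF THE CURVED CORNER-FRAME LEGS WITH THE `ℓ⁻²`-ANCHORED B-SLOT ROWS —
# the re-cut of ✓(K2-S) `Prop7RLegsCovScalar.scalar_legs_knit` in which the two per-level rows carry their curvature terms in the WEAKEST shape the legs recursion tolerates,
# `e²·Lˡ·(Lᵏ)⁻²·SA` (rate `L`, anchored at the top `ℓ = Lᵏ`), instead of `e²·L^{3l}·(Lᵏ)⁻⁴·SA` (crux `MinimiserStabilityRegPr`, stmt-QuantumFields-19200, EX lane, hN06 LANE II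
# supplier (R-LEGS); `--supports stmt-QuantumFields-19200 --as helper`, count-neutral)

Cell `ym3-torus` (HUMAN RULING D-0037: YM₃ on T³ is ladder rung R3 — NOT d = 4, NOT infinite volume, NOT a mass gap, NOT the Clay problem), width seat `ym-ust-20520-w4` (g13), steward of
the curved row `rlegs` ∕ the (K2) knit.  THEOREMS ONLY (0 `def`, 0 `sorry`), PURE REAL ARITHMETIC; nothing here claims (R-LEGS-cov), (QB), (QH1), (REC), `hN06`, EX or the crux.

WHY (★routeR-w2 g10 LOCATE #62 (4), px18 g5 F-8′ plan, w4 g12's tolerance «any window `w(e)·Lˡ·ℓ⁻²·SA`»).  ★routeR's lane closes the linear-response rows of the comb single-bar tower in the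
PURE B-SLOT with the TOP anchor (✓`Prop7CornerCombLambdaClosureSharp.grad_full_B_slot_of_rows`: `Ĝ = g₀ + θ_g e′m₀·ρ^{2k}·ρ³∕(1−ρ²)`, on `T³` `ρ^{2k} = (Lᵏ)⁻¹`, `((ρ⁻¹)ˡ)² = Lˡ`), i.e. the
curvature contribution to the rows arrives as `const(L)·eᵖ·Lˡ·(Lᵏ)⁻²·SA` (`p ≥ 1`) — `l`-UNIFORMLY anchored — whereas ✓(K2-S) displayed the `l`-sharp `e²·L^{3l}·(Lᵏ)⁻⁴·SA`
(`= e²·Lˡ(Lᵏ)⁻²·SA·(L^{2l}(Lᵏ)⁻²) ≤ e²·Lˡ(Lᵏ)⁻²·SA`: the new rows are WEAKER hypotheses, so this file supersedes nothing and strengthens the knit).  THE POINT: a source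
`c·e²·SA·(Lᵏ)⁻²·Lˡ` has rate `L > 4L⁻¹` and propagates to `c∕(L−4L⁻¹)·e²·SA·(Lᵏ)⁻²·Lᵏ ≤ c′·e·(Lᵏ)⁻¹·SA` at the top — exactly the `Cr′` slot of (R-LEGS-cov).

Letters as in ✓(K2-S): for `l < k = K − n`, `E_{l+1} ≤ 4L⁻¹·E_l + pM·a_l²·M_l + aG·G_l + pN·a_l²·N_l`, `M_{l+1} ≤ 2L⁻³·M_l + bN·N_l`, `E_0 ≤ 0`, `M_0 ≤ 0`, `0 ≤ a_l ≤ 4e·(Lˡ·(Lᵏ)⁻¹)²`, and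
the two rows `G_l ≤ CG·Lˡ·GA + CG′·e²·Lˡ·(Lᵏ)⁻²·SA`, `N_l ≤ CN·L⁻ˡ·SA + CN′·Lˡ·GA + CN″·e²·Lˡ·(Lᵏ)⁻²·SA`.
* §1 `pow_mul_inv_pow_two_le` (`Lˡ(Lᵏ)⁻² ≤ (Lˡ)⁻¹`), `inv_pow_two_mul_pow_eq` (`(Lᵏ)⁻²·Lᵏ = (Lᵏ)⁻¹`).
* §2 `legsMass_le_B` — `M_l ≤ m₁·SA·(L⁻¹)ˡ + m₂·GA·Lˡ` with the SAME `m₁ = bN(CN + CN″)∕(L⁻¹ − 2L⁻³)`, `m₂ = bN·CN′∕(L − 2L⁻³)` as ✓`legsMass_le`.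
* §3 `legsSource_le_B` — the sources are dominated by the two rates `L, L³`: `≤ α·Lˡ + β·(L³)ˡ`, `α = aG·CG·GA + 16e²(pM·m₂ + pN·CN′)·GA + e²·(aG·CG′ + 16e²·pN·CN″)·SA·(Lᵏ)⁻²`,
  `β = e²(16pM·m₁ + 16pN·CN)·SA·(Lᵏ)⁻⁴`.
* §4 `top_read_B` (the two rates read at the ceiling) · §5 ★★★ `scalar_legs_knit_B` — `E_k ≤ Cr·Lᵏ·GA + Cr′·e·(Lᵏ)⁻¹·SA`, `Cr = (aG·CG + 16(pM·m₂ + pN·CN′))∕(L − 4L⁻¹)`, `Cr′ = (aG·CG′ + 16pN·CN″)∕(L − 4L⁻¹) + (16pM·m₁ + 16pN·CN)∕(L³ − 4L⁻¹)`.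
HONEST SCOPE.  Real arithmetic only; the member knit with these rows is the next file.  Rung R3; nothing of the crux ∕ the gap is claimed.

References: T. Bałaban, CMP 98 (1985) 17–51 [Balaban1985Averaging] ((97) p.32, (110)–(112) p.34, (160)–(163) p.42); CMP 109 (1987) 249–301 [Balaban1987RG1] ((0.1)–(0.4) pp.251–253).
-/

set_option autoImplicit false

noncomputable section

open scoped BigOperators

namespace Summit.QuantumFields.YangMills.Theorems.Prop7RLegsCovScalarB

open Summit.QuantumFields.YangMills.Theorems.Prop7RLegsCovScalar (rec_two_rates_le_upto pow_four_mul_inv_pow_four_le_one pow_four_mul_inv_mul_inv_eq curvature_sq_le)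

/-! ## §1 The anchored-slot dictionary -/

/-- `Lˡ·(Lᵏ)⁻² ≤ (Lˡ)⁻¹` for `l ≤ k`, `L ≥ 1` — the `ℓ⁻²`-anchored B-slot is below the A-slot at every level. [cite: Balaban1985Averaging, (163) p.42] -/
theorem pow_mul_inv_pow_two_le {L : ℝ} (hL : 1 ≤ L) {l k : ℕ} (hl : l ≤ k) : L ^ l * ((L ^ k) ^ 2)⁻¹ ≤ (L ^ l)⁻¹ := by
  have hL0 : 0 < L := by linarith
  have hLl : 0 < L ^ l := pow_pos hL0 l
  have hLk2 : 0 < (L ^ k) ^ 2 := pow_pos (pow_pos hL0 k) 2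
  rw [mul_inv_le_iff₀ hLk2, ← div_eq_inv_mul, le_div_iff₀ hLl]
  calc L ^ l * L ^ l = (L ^ l) ^ 2 := (sq (L ^ l)).symm
    _ ≤ (L ^ k) ^ 2 := pow_le_pow_left₀ hLl.le (pow_le_pow_right₀ hL hl) 2

/-- `(Lᵏ)⁻²·Lᵏ = (Lᵏ)⁻¹` (`L ≠ 0`). [cite: Balaban1985Averaging, (163) p.42] -/
theorem inv_pow_two_mul_pow_eq {L : ℝ} (hL : L ≠ 0) (k : ℕ) : ((L ^ k) ^ 2)⁻¹ * L ^ k = (L ^ k)⁻¹ := by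
  have hne : L ^ k ≠ 0 := pow_ne_zero k hL
  rw [sq, mul_inv_rev, mul_assoc, inv_mul_cancel₀ hne, mul_one]

/-- `(Lᵏ)⁻⁴·(L³)ᵏ = (Lᵏ)⁻¹` (`L ≠ 0`). [cite: Balaban1985Averaging, (163) p.42] -/
theorem inv_pow_four_mul_pow_three_eq {L : ℝ} (hL : L ≠ 0) (k : ℕ) : ((L ^ k) ^ 4)⁻¹ * (L ^ 3) ^ k = (L ^ k)⁻¹ := by
  have hne : L ^ k ≠ 0 := pow_ne_zero k hL
  have h3 : (L ^ 3) ^ k = (L ^ k) ^ 3 := by rw [← pow_mul, ← pow_mul, mul_comm]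
  rw [h3]
  calc ((L ^ k) ^ 4)⁻¹ * (L ^ k) ^ 3 = ((L ^ k) ^ 3 * L ^ k)⁻¹ * (L ^ k) ^ 3 := by rw [← pow_succ]
    _ = (L ^ k)⁻¹ * (((L ^ k) ^ 3)⁻¹ * (L ^ k) ^ 3) := by rw [mul_inv_rev]; ring
    _ = (L ^ k)⁻¹ := by rw [inv_mul_cancel₀ (pow_ne_zero 3 hne), mul_one]

/-! ## §2 The legs-mass with the anchored mass row -/

/-- **THE LEGS-MASS BOUND, ANCHORED ROW**: `M_0 ≤ 0`, `M_{l+1} ≤ 2L⁻³M_l + bN·N_l` and the mass row `N_l ≤ CN·L⁻ˡ·SA + CN′·Lˡ·GA + CN″·e²·Lˡ·(Lᵏ)⁻²·SA` for `l < k` ⇒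
`M_l ≤ m₁·SA·(L⁻¹)ˡ + m₂·GA·Lˡ` (`l ≤ k`), `m₁ = bN(CN + CN″)∕(L⁻¹ − 2L⁻³)`, `m₂ = bN·CN′∕(L − 2L⁻³)` (`L ≥ 3`, `0 ≤ e ≤ 1`). [cite: Balaban1985Averaging, (97) p.32, (163) p.42] -/
theorem legsMass_le_B {L : ℝ} (hL : 3 ≤ L) {bN CN CN' CN'' : ℝ} (hbN : 0 ≤ bN) (hCN : 0 ≤ CN) (hCN' : 0 ≤ CN') (hCN'' : 0 ≤ CN'') (k : ℕ) {e GA SA : ℝ}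
    (he0 : 0 ≤ e) (he1 : e ≤ 1) (hGA : 0 ≤ GA) (hSA : 0 ≤ SA) (M N : ℕ → ℝ) (hM0 : M 0 ≤ 0)
    (hN : ∀ l, l < k → N l ≤ CN * (L ^ l)⁻¹ * SA + CN' * L ^ l * GA + CN'' * e ^ 2 * L ^ l * ((L ^ k) ^ 2)⁻¹ * SA)
    (hM : ∀ l, l < k → M (l + 1) ≤ 2 * (L ^ 3)⁻¹ * M l + bN * N l) :
    ∀ l, l ≤ k → M l ≤ bN * (CN + CN'') / (L⁻¹ - 2 * (L ^ 3)⁻¹) * SA * L⁻¹ ^ l + bN * CN' / (L - 2 * (L ^ 3)⁻¹) * GA * L ^ l := by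
  have hL0 : 0 < L := by linarith
  have hL1 : 1 ≤ L := by linarith
  have hqM0 : 0 ≤ 2 * (L ^ 3)⁻¹ := by positivity
  have hgapM1 : 2 * (L ^ 3)⁻¹ < L⁻¹ := by
    rw [show L ^ 3 = L * L * L by ring, mul_inv, mul_inv]
    have hLi : 0 < L⁻¹ := inv_pos.2 hL0
    have hLi1 : L⁻¹ ≤ 1 / 3 := by rw [inv_eq_one_div]; exact one_div_le_one_div_of_le (by norm_num) hL
    nlinarith [mul_pos hLi hLi, mul_pos (mul_pos hLi hLi) hLi]
  have hgapM2 : 2 * (L ^ 3)⁻¹ < L := lt_of_lt_of_le (hgapM1.trans_le (inv_le_one_of_one_le₀ hL1)) hL1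
  have h := rec_two_rates_le_upto hqM0 hgapM1 hgapM2 (show 0 ≤ bN * (CN + CN'') * SA by positivity) (show 0 ≤ bN * CN' * GA by positivity) k M
    (fun l => bN * N l) hM0 hM ?_
  · intro l hl
    refine (h l hl).trans (le_of_eq ?_)
    ring
  · intro l hl
    have h1 := hN l hl
    have hd := pow_mul_inv_pow_two_le hL1 hl.le
    have h2 : CN'' * e ^ 2 * L ^ l * ((L ^ k) ^ 2)⁻¹ * SA ≤ CN'' * (L ^ l)⁻¹ * SA := by
      have h0 : 0 ≤ CN'' * e ^ 2 := by positivity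
      have he21 : e ^ 2 ≤ 1 := by nlinarith
      calc CN'' * e ^ 2 * L ^ l * ((L ^ k) ^ 2)⁻¹ * SA = CN'' * e ^ 2 * (L ^ l * ((L ^ k) ^ 2)⁻¹) * SA := by ring
        _ ≤ CN'' * e ^ 2 * (L ^ l)⁻¹ * SA := mul_le_mul_of_nonneg_right (mul_le_mul_of_nonneg_left hd h0) hSA
        _ ≤ CN'' * 1 * (L ^ l)⁻¹ * SA := by gcongr
        _ = CN'' * (L ^ l)⁻¹ * SA := by ring
    have hinv : (L ^ l)⁻¹ = L⁻¹ ^ l := (inv_pow L l).symm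
    calc bN * N l ≤ bN * (CN * (L ^ l)⁻¹ * SA + CN' * L ^ l * GA + CN'' * (L ^ l)⁻¹ * SA) := mul_le_mul_of_nonneg_left (by linarith) hbN
      _ = bN * (CN + CN'') * SA * L⁻¹ ^ l + bN * CN' * GA * L ^ l := by rw [← hinv]; ring

/-! ## §3 The sources under the anchored rows -/

/-- **THE LEGS SOURCES ARE DOMINATED BY THE TWO RATES `L, L³` (ANCHORED ROWS)**: with the legs-mass bound (`m₁ m₂ ≥ 0`), the anchored rows and the curvature square, for `l < k`,
`pM·a_l²·M_l + aG·G_l + pN·a_l²·N_l ≤ α·Lˡ + β·(L³)ˡ`, `α = aG·CG·GA + 16e²(pM·m₂·GA + pN·CN′·GA) + e²·(aG·CG′ + 16e²·pN·CN″)·SA·(Lᵏ)⁻²`, `β = e²(16pM·m₁ + 16pN·CN)·SA·(Lᵏ)⁻⁴`.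
[cite: Balaban1985Averaging, (97) p.32, (110)–(112) p.34, (163) p.42] -/
theorem legsSource_le_B {L : ℝ} (hL : 1 ≤ L) {pM aG pN CG CG' CN CN' CN'' m1 m2 : ℝ} (hpM : 0 ≤ pM) (haG : 0 ≤ aG) (hpN : 0 ≤ pN)
    (hCN' : 0 ≤ CN') (hCN'' : 0 ≤ CN'') (hm2 : 0 ≤ m2) {k : ℕ} {e GA SA : ℝ} (hGA : 0 ≤ GA) (hSA : 0 ≤ SA)
    (M G N a : ℕ → ℝ) (hMnn : ∀ l, 0 ≤ M l) (hNnn : ∀ l, 0 ≤ N l) (hann : ∀ l, 0 ≤ a l)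
    (ha : ∀ l, l < k → a l ≤ 4 * e * (L ^ l * (L ^ k)⁻¹) ^ 2)
    (hG : ∀ l, l < k → G l ≤ CG * L ^ l * GA + CG' * e ^ 2 * L ^ l * ((L ^ k) ^ 2)⁻¹ * SA)
    (hN : ∀ l, l < k → N l ≤ CN * (L ^ l)⁻¹ * SA + CN' * L ^ l * GA + CN'' * e ^ 2 * L ^ l * ((L ^ k) ^ 2)⁻¹ * SA)
    (hMb : ∀ l, l ≤ k → M l ≤ m1 * SA * L⁻¹ ^ l + m2 * GA * L ^ l) :
    ∀ l, l < k → pM * a l ^ 2 * M l + aG * G l + pN * a l ^ 2 * N l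
      ≤ (aG * CG * GA + 16 * e ^ 2 * (pM * m2 * GA + pN * CN' * GA) + e ^ 2 * (aG * CG' + 16 * e ^ 2 * pN * CN'') * SA * ((L ^ k) ^ 2)⁻¹) * L ^ l
        + e ^ 2 * (16 * pM * m1 + 16 * pN * CN) * SA * ((L ^ k) ^ 4)⁻¹ * (L ^ 3) ^ l := by
  intro l hl
  have hL0 : 0 < L := by linarith
  have hLl : 0 < L ^ l := pow_pos hL0 l
  have hLk4i : 0 ≤ ((L ^ k) ^ 4)⁻¹ := by positivity
  have hLk2i : 0 ≤ ((L ^ k) ^ 2)⁻¹ := by positivity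
  have hinv : (L ^ l)⁻¹ = L⁻¹ ^ l := (inv_pow L l).symm
  set A4 : ℝ := (L ^ l) ^ 4 * ((L ^ k) ^ 4)⁻¹ with hA4d
  have hA41 : A4 ≤ 1 := pow_four_mul_inv_pow_four_le_one hL hl.le
  have hA40 : 0 ≤ A4 := by positivity
  have ha2 : a l ^ 2 ≤ 16 * e ^ 2 * A4 := curvature_sq_le (hann l) (ha l hl)
  have e1 : A4 * (L ^ l)⁻¹ = ((L ^ k) ^ 4)⁻¹ * (L ^ 3) ^ l := pow_four_mul_inv_mul_inv_eq hL0.ne' l k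
  have e2 : A4 * L ^ l ≤ L ^ l := mul_le_of_le_one_left hLl.le hA41
  -- (i) the mass slot (unchanged from ✓(K2-S))
  have hi : pM * a l ^ 2 * M l ≤ 16 * e ^ 2 * (pM * m2 * GA) * L ^ l + e ^ 2 * (16 * pM * m1) * SA * ((L ^ k) ^ 4)⁻¹ * (L ^ 3) ^ l := by
    have h1 : pM * a l ^ 2 * M l ≤ pM * (16 * e ^ 2 * A4) * (m1 * SA * L⁻¹ ^ l + m2 * GA * L ^ l) :=
      (mul_le_mul_of_nonneg_right (mul_le_mul_of_nonneg_left ha2 hpM) (hMnn l)).trans (mul_le_mul_of_nonneg_left (hMb l hl.le) (by positivity))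
    refine h1.trans ?_
    have t1 : pM * (16 * e ^ 2 * A4) * (m1 * SA * L⁻¹ ^ l) = e ^ 2 * (16 * pM * m1) * SA * ((L ^ k) ^ 4)⁻¹ * (L ^ 3) ^ l := by
      rw [← hinv]
      calc pM * (16 * e ^ 2 * A4) * (m1 * SA * (L ^ l)⁻¹) = e ^ 2 * (16 * pM * m1) * SA * (A4 * (L ^ l)⁻¹) := by ring
        _ = _ := by rw [e1]; ring
    have t2 : pM * (16 * e ^ 2 * A4) * (m2 * GA * L ^ l) ≤ 16 * e ^ 2 * (pM * m2 * GA) * L ^ l := by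
      calc pM * (16 * e ^ 2 * A4) * (m2 * GA * L ^ l) = 16 * e ^ 2 * (pM * m2 * GA) * (A4 * L ^ l) := by ring
        _ ≤ _ := mul_le_mul_of_nonneg_left e2 (by positivity)
    rw [mul_add]; linarith
  -- (ii) the gradient slot: both terms have rate `L`
  have hii : aG * G l ≤ aG * CG * GA * L ^ l + e ^ 2 * (aG * CG') * SA * ((L ^ k) ^ 2)⁻¹ * L ^ l := by
    refine (mul_le_mul_of_nonneg_left (hG l hl) haG).trans (le_of_eq ?_)
    ring
  -- (iii) the tower-mass slot
  have hiii : pN * a l ^ 2 * N l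
      ≤ 16 * e ^ 2 * (pN * CN' * GA) * L ^ l + e ^ 2 * (16 * e ^ 2 * pN * CN'') * SA * ((L ^ k) ^ 2)⁻¹ * L ^ l
        + e ^ 2 * (16 * pN * CN) * SA * ((L ^ k) ^ 4)⁻¹ * (L ^ 3) ^ l := by
    have h1 : pN * a l ^ 2 * N l ≤ pN * (16 * e ^ 2 * A4) * (CN * (L ^ l)⁻¹ * SA + CN' * L ^ l * GA + CN'' * e ^ 2 * L ^ l * ((L ^ k) ^ 2)⁻¹ * SA) :=
      (mul_le_mul_of_nonneg_right (mul_le_mul_of_nonneg_left ha2 hpN) (hNnn l)).trans (mul_le_mul_of_nonneg_left (hN l hl) (by positivity))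
    refine h1.trans ?_
    have t1 : pN * (16 * e ^ 2 * A4) * (CN * (L ^ l)⁻¹ * SA) = e ^ 2 * (16 * pN * CN) * SA * ((L ^ k) ^ 4)⁻¹ * (L ^ 3) ^ l := by
      calc pN * (16 * e ^ 2 * A4) * (CN * (L ^ l)⁻¹ * SA) = e ^ 2 * (16 * pN * CN) * SA * (A4 * (L ^ l)⁻¹) := by ring
        _ = _ := by rw [e1]; ring
    have t2 : pN * (16 * e ^ 2 * A4) * (CN' * L ^ l * GA) ≤ 16 * e ^ 2 * (pN * CN' * GA) * L ^ l := by
      calc pN * (16 * e ^ 2 * A4) * (CN' * L ^ l * GA) = 16 * e ^ 2 * (pN * CN' * GA) * (A4 * L ^ l) := by ring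
        _ ≤ _ := mul_le_mul_of_nonneg_left e2 (by positivity)
    have t3 : pN * (16 * e ^ 2 * A4) * (CN'' * e ^ 2 * L ^ l * ((L ^ k) ^ 2)⁻¹ * SA) ≤ e ^ 2 * (16 * e ^ 2 * pN * CN'') * SA * ((L ^ k) ^ 2)⁻¹ * L ^ l := by
      calc pN * (16 * e ^ 2 * A4) * (CN'' * e ^ 2 * L ^ l * ((L ^ k) ^ 2)⁻¹ * SA)
          = e ^ 2 * (16 * e ^ 2 * pN * CN'') * SA * ((L ^ k) ^ 2)⁻¹ * (A4 * L ^ l) := by ring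
        _ ≤ e ^ 2 * (16 * e ^ 2 * pN * CN'') * SA * ((L ^ k) ^ 2)⁻¹ * L ^ l := mul_le_mul_of_nonneg_left e2 (by positivity)
    rw [mul_add, mul_add]; linarith
  have hsum : aG * CG * GA * L ^ l + e ^ 2 * (aG * CG') * SA * ((L ^ k) ^ 2)⁻¹ * L ^ l
      + (16 * e ^ 2 * (pN * CN' * GA) * L ^ l + e ^ 2 * (16 * e ^ 2 * pN * CN'') * SA * ((L ^ k) ^ 2)⁻¹ * L ^ l)
      + 16 * e ^ 2 * (pM * m2 * GA) * L ^ l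
      = (aG * CG * GA + 16 * e ^ 2 * (pM * m2 * GA + pN * CN' * GA) + e ^ 2 * (aG * CG' + 16 * e ^ 2 * pN * CN'') * SA * ((L ^ k) ^ 2)⁻¹) * L ^ l := by
    ring
  linarith

/-! ## §4 Reading the two rates at the top -/

/-- **THE TOP READING**: the two propagated rates at the ceiling, `α∕(L−4L⁻¹)·Lᵏ + β∕(L³−4L⁻¹)·(L³)ᵏ`, are `≤ Cr·Lᵏ·GA + Cr′·e·(Lᵏ)⁻¹·SA` with the constants of `scalar_legs_knit_B`
(`e² ≤ e ≤ 1`, `(Lᵏ)⁻²·Lᵏ = (Lᵏ)⁻¹ = (Lᵏ)⁻⁴·(L³)ᵏ`). [cite: Balaban1985Averaging, (97) p.32, (163) p.42] -/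
theorem top_read_B {L e GA SA aG CG CG' pM pN CN CN' CN'' m1 m2 : ℝ} (hL0 : 0 < L) (he0 : 0 ≤ e) (he1 : e ≤ 1) (hGA : 0 ≤ GA) (hSA : 0 ≤ SA)
    (haG : 0 ≤ aG) (hCG' : 0 ≤ CG') (hpM : 0 ≤ pM) (hpN : 0 ≤ pN) (hCN : 0 ≤ CN) (hCN' : 0 ≤ CN') (hCN'' : 0 ≤ CN'') (hm1 : 0 ≤ m1) (hm2 : 0 ≤ m2)
    (hgap1 : 0 < L - 4 * L⁻¹) (hgap2 : 0 < L ^ 3 - 4 * L⁻¹) (k : ℕ) :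
    (aG * CG * GA + 16 * e ^ 2 * (pM * m2 * GA + pN * CN' * GA) + e ^ 2 * (aG * CG' + 16 * e ^ 2 * pN * CN'') * SA * ((L ^ k) ^ 2)⁻¹) / (L - 4 * L⁻¹) * L ^ k
        + e ^ 2 * (16 * pM * m1 + 16 * pN * CN) * SA * ((L ^ k) ^ 4)⁻¹ / (L ^ 3 - 4 * L⁻¹) * (L ^ 3) ^ k
      ≤ (aG * CG + 16 * (pM * m2 + pN * CN')) / (L - 4 * L⁻¹) * L ^ k * GA
        + ((aG * CG' + 16 * pN * CN'') / (L - 4 * L⁻¹) + (16 * pM * m1 + 16 * pN * CN) / (L ^ 3 - 4 * L⁻¹)) * e * (L ^ k)⁻¹ * SA := by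
  have he2 : e ^ 2 ≤ e := by nlinarith
  have he21 : e ^ 2 ≤ 1 := he2.trans he1
  have hLk : 0 < L ^ k := pow_pos hL0 k
  have hk2 : ((L ^ k) ^ 2)⁻¹ * L ^ k = (L ^ k)⁻¹ := inv_pow_two_mul_pow_eq hL0.ne' k
  have hk3 : ((L ^ k) ^ 4)⁻¹ * (L ^ 3) ^ k = (L ^ k)⁻¹ := inv_pow_four_mul_pow_three_eq hL0.ne' k
  -- the rate-`L` slot
  have s1 : e ^ 2 * ((pM * m2 + pN * CN') * GA) ≤ 1 * ((pM * m2 + pN * CN') * GA) := mul_le_mul_of_nonneg_right he21 (by positivity)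
  have s2 : e ^ 2 * (aG * CG' + 16 * e ^ 2 * pN * CN'') ≤ e * (aG * CG' + 16 * pN * CN'') := by
    have h1 : e ^ 2 * (pN * CN'') ≤ 1 * (pN * CN'') := mul_le_mul_of_nonneg_right he21 (by positivity)
    have h2 : aG * CG' + 16 * e ^ 2 * pN * CN'' ≤ aG * CG' + 16 * pN * CN'' := by linarith
    have h0 : 0 ≤ aG * CG' + 16 * e ^ 2 * pN * CN'' := by positivity
    calc e ^ 2 * (aG * CG' + 16 * e ^ 2 * pN * CN'') ≤ e * (aG * CG' + 16 * e ^ 2 * pN * CN'') := mul_le_mul_of_nonneg_right he2 h0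
      _ ≤ e * (aG * CG' + 16 * pN * CN'') := mul_le_mul_of_nonneg_left h2 he0
  have s3 : e ^ 2 * (aG * CG' + 16 * e ^ 2 * pN * CN'') * SA * ((L ^ k) ^ 2)⁻¹ * L ^ k ≤ (aG * CG' + 16 * pN * CN'') * e * (L ^ k)⁻¹ * SA := by
    calc e ^ 2 * (aG * CG' + 16 * e ^ 2 * pN * CN'') * SA * ((L ^ k) ^ 2)⁻¹ * L ^ k
        = e ^ 2 * (aG * CG' + 16 * e ^ 2 * pN * CN'') * SA * (((L ^ k) ^ 2)⁻¹ * L ^ k) := by ring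
      _ ≤ e * (aG * CG' + 16 * pN * CN'') * SA * (((L ^ k) ^ 2)⁻¹ * L ^ k) :=
          mul_le_mul_of_nonneg_right (mul_le_mul_of_nonneg_right s2 hSA) (by positivity)
      _ = _ := by rw [hk2]; ring
  have s4 : (aG * CG * GA + 16 * e ^ 2 * (pM * m2 * GA + pN * CN' * GA)) * L ^ k ≤ (aG * CG + 16 * (pM * m2 + pN * CN')) * GA * L ^ k := by
    refine mul_le_mul_of_nonneg_right ?_ hLk.le
    have h16 := mul_le_mul_of_nonneg_left s1 (show (0 : ℝ) ≤ 16 by norm_num)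
    have e1 : aG * CG * GA + 16 * e ^ 2 * (pM * m2 * GA + pN * CN' * GA) = aG * CG * GA + 16 * (e ^ 2 * ((pM * m2 + pN * CN') * GA)) := by ring
    have e2 : (aG * CG + 16 * (pM * m2 + pN * CN')) * GA = aG * CG * GA + 16 * (1 * ((pM * m2 + pN * CN') * GA)) := by ring
    rw [e1, e2]; linarith
  have hαle : (aG * CG * GA + 16 * e ^ 2 * (pM * m2 * GA + pN * CN' * GA) + e ^ 2 * (aG * CG' + 16 * e ^ 2 * pN * CN'') * SA * ((L ^ k) ^ 2)⁻¹) * L ^ k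
      ≤ (aG * CG + 16 * (pM * m2 + pN * CN')) * GA * L ^ k + (aG * CG' + 16 * pN * CN'') * e * (L ^ k)⁻¹ * SA := by
    rw [add_mul]; exact add_le_add s4 s3
  -- the rate-`L³` slot
  have hβle : e ^ 2 * (16 * pM * m1 + 16 * pN * CN) * SA * ((L ^ k) ^ 4)⁻¹ * (L ^ 3) ^ k ≤ (16 * pM * m1 + 16 * pN * CN) * e * (L ^ k)⁻¹ * SA := by
    have h1 : e ^ 2 * (16 * pM * m1 + 16 * pN * CN) ≤ (16 * pM * m1 + 16 * pN * CN) * e := by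
      have s0 : 0 ≤ 16 * pM * m1 + 16 * pN * CN := by positivity
      calc e ^ 2 * (16 * pM * m1 + 16 * pN * CN) ≤ e * (16 * pM * m1 + 16 * pN * CN) := mul_le_mul_of_nonneg_right he2 s0
        _ = _ := by ring
    calc e ^ 2 * (16 * pM * m1 + 16 * pN * CN) * SA * ((L ^ k) ^ 4)⁻¹ * (L ^ 3) ^ k
        = e ^ 2 * (16 * pM * m1 + 16 * pN * CN) * SA * (((L ^ k) ^ 4)⁻¹ * (L ^ 3) ^ k) := by ring
      _ ≤ (16 * pM * m1 + 16 * pN * CN) * e * SA * (((L ^ k) ^ 4)⁻¹ * (L ^ 3) ^ k) :=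
          mul_le_mul_of_nonneg_right (mul_le_mul_of_nonneg_right h1 hSA) (by positivity)
      _ = _ := by rw [hk3]; ring
  -- divide by the gaps
  have d1 := div_le_div_of_nonneg_right hαle hgap1.le
  have d2 := div_le_div_of_nonneg_right hβle hgap2.le
  have e1 : (aG * CG * GA + 16 * e ^ 2 * (pM * m2 * GA + pN * CN' * GA) + e ^ 2 * (aG * CG' + 16 * e ^ 2 * pN * CN'') * SA * ((L ^ k) ^ 2)⁻¹) / (L - 4 * L⁻¹) * L ^ k
      = (aG * CG * GA + 16 * e ^ 2 * (pM * m2 * GA + pN * CN' * GA) + e ^ 2 * (aG * CG' + 16 * e ^ 2 * pN * CN'') * SA * ((L ^ k) ^ 2)⁻¹) * L ^ k / (L - 4 * L⁻¹) := by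
    ring
  have e2 : e ^ 2 * (16 * pM * m1 + 16 * pN * CN) * SA * ((L ^ k) ^ 4)⁻¹ / (L ^ 3 - 4 * L⁻¹) * (L ^ 3) ^ k
      = e ^ 2 * (16 * pM * m1 + 16 * pN * CN) * SA * ((L ^ k) ^ 4)⁻¹ * (L ^ 3) ^ k / (L ^ 3 - 4 * L⁻¹) := by
    ring
  have e3 : (aG * CG + 16 * (pM * m2 + pN * CN')) / (L - 4 * L⁻¹) * L ^ k * GA
        + ((aG * CG' + 16 * pN * CN'') / (L - 4 * L⁻¹) + (16 * pM * m1 + 16 * pN * CN) / (L ^ 3 - 4 * L⁻¹)) * e * (L ^ k)⁻¹ * SA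
      = ((aG * CG + 16 * (pM * m2 + pN * CN')) * GA * L ^ k + (aG * CG' + 16 * pN * CN'') * e * (L ^ k)⁻¹ * SA) / (L - 4 * L⁻¹)
        + (16 * pM * m1 + 16 * pN * CN) * e * (L ^ k)⁻¹ * SA / (L ^ 3 - 4 * L⁻¹) := by
    field_simp
    ring
  rw [e1, e2, e3]
  exact add_le_add d1 d2

/-! ## §5 ★★★ The scalar knit with the anchored rows -/

/-- ★★★ **(K2-S′) THE SCALAR KNIT OF (R-LEGS-cov), `ℓ⁻²`-ANCHORED ROWS**: for `L ≥ 3` and nonnegative structure constants `pM aG pN bN CG CG′ CN CN′ CN″` there are `Cr, Cr′ ≥ 0`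
(functions of these only) such that for every ceiling `k`, every `0 < e ≤ 1`, `GA, SA ≥ 0` and all sequences `E M G N a` with `E_0 ≤ 0`, `M_0 ≤ 0`, `M, N ≥ 0`,
`0 ≤ a_l ≤ 4e(Lˡ(Lᵏ)⁻¹)²` (`l < k`), the two ANCHORED rows `G_l ≤ CG·Lˡ·GA + CG′·e²·Lˡ·(Lᵏ)⁻²·SA`, `N_l ≤ CN·L⁻ˡ·SA + CN′·Lˡ·GA + CN″·e²·Lˡ·(Lᵏ)⁻²·SA` and the two one-step
recursions below `k`, one has `E_k ≤ Cr·Lᵏ·GA + Cr′·e·(Lᵏ)⁻¹·SA`. [cite: Balaban1985Averaging, (97) p.32, (110)–(112) p.34, (160)–(163) p.42; Balaban1987RG1, (0.1)–(0.4) pp.251–253] -/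
theorem scalar_legs_knit_B {L : ℝ} (hL : 3 ≤ L) {pM aG pN bN CG CG' CN CN' CN'' : ℝ} (hpM : 0 ≤ pM) (haG : 0 ≤ aG) (hpN : 0 ≤ pN) (hbN : 0 ≤ bN)
    (hCG : 0 ≤ CG) (hCG' : 0 ≤ CG') (hCN : 0 ≤ CN) (hCN' : 0 ≤ CN') (hCN'' : 0 ≤ CN'') :
    ∃ Cr Cr' : ℝ, 0 ≤ Cr ∧ 0 ≤ Cr' ∧
      ∀ (k : ℕ) (e GA SA : ℝ), 0 < e → e ≤ 1 → 0 ≤ GA → 0 ≤ SA →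
      ∀ (E M G N a : ℕ → ℝ), E 0 ≤ 0 → M 0 ≤ 0 → (∀ l, 0 ≤ M l) → (∀ l, 0 ≤ N l) → (∀ l, 0 ≤ a l) →
        (∀ l, l < k → a l ≤ 4 * e * (L ^ l * (L ^ k)⁻¹) ^ 2) →
        (∀ l, l < k → G l ≤ CG * L ^ l * GA + CG' * e ^ 2 * L ^ l * ((L ^ k) ^ 2)⁻¹ * SA) →
        (∀ l, l < k → N l ≤ CN * (L ^ l)⁻¹ * SA + CN' * L ^ l * GA + CN'' * e ^ 2 * L ^ l * ((L ^ k) ^ 2)⁻¹ * SA) →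
        (∀ l, l < k → M (l + 1) ≤ 2 * (L ^ 3)⁻¹ * M l + bN * N l) →
        (∀ l, l < k → E (l + 1) ≤ 4 * L⁻¹ * E l + pM * a l ^ 2 * M l + aG * G l + pN * a l ^ 2 * N l) →
        E k ≤ Cr * L ^ k * GA + Cr' * e * (L ^ k)⁻¹ * SA := by
  have hL0 : 0 < L := by linarith
  have hL1 : 1 ≤ L := by linarith
  have hq0 : 0 ≤ 4 * L⁻¹ := by positivity
  have hgapE1 : 4 * L⁻¹ < L := by
    have h1 : 4 * L⁻¹ ≤ 4 / 3 := by
      rw [← div_eq_mul_inv]; exact div_le_div_of_nonneg_left (by norm_num) (by norm_num) hL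
    linarith
  have hgapE2 : 4 * L⁻¹ < L ^ 3 := by
    refine hgapE1.trans_le ?_
    calc L = L ^ 1 := (pow_one L).symm
      _ ≤ L ^ 3 := pow_le_pow_right₀ hL1 (by norm_num)
  have hgapM1 : 0 < L⁻¹ - 2 * (L ^ 3)⁻¹ := by
    rw [show L ^ 3 = L * L * L by ring, mul_inv, mul_inv]
    have hLi : 0 < L⁻¹ := inv_pos.2 hL0
    have hLi1 : L⁻¹ ≤ 1 / 3 := by rw [inv_eq_one_div]; exact one_div_le_one_div_of_le (by norm_num) hL
    nlinarith [mul_pos hLi hLi, mul_pos (mul_pos hLi hLi) hLi]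
  have hgapM2 : 0 < L - 2 * (L ^ 3)⁻¹ := by
    have : L⁻¹ ≤ L := (inv_le_one_of_one_le₀ hL1).trans hL1
    linarith
  have hm10 : 0 ≤ bN * (CN + CN'') / (L⁻¹ - 2 * (L ^ 3)⁻¹) := div_nonneg (by positivity) hgapM1.le
  have hm20 : 0 ≤ bN * CN' / (L - 2 * (L ^ 3)⁻¹) := div_nonneg (by positivity) hgapM2.le
  have hgap1 : 0 < L - 4 * L⁻¹ := by linarith
  have hgap2 : 0 < L ^ 3 - 4 * L⁻¹ := by linarith
  refine ⟨(aG * CG + 16 * (pM * (bN * CN' / (L - 2 * (L ^ 3)⁻¹)) + pN * CN')) / (L - 4 * L⁻¹),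
    (aG * CG' + 16 * pN * CN'') / (L - 4 * L⁻¹) + (16 * pM * (bN * (CN + CN'') / (L⁻¹ - 2 * (L ^ 3)⁻¹)) + 16 * pN * CN) / (L ^ 3 - 4 * L⁻¹),
    div_nonneg (by positivity) hgap1.le, add_nonneg (div_nonneg (by positivity) hgap1.le) (div_nonneg (by positivity) hgap2.le), ?_⟩
  intro k e GA SA he he1 hGA hSA E M G N a hE0 hM0 hMnn hNnn hann ha hG hN hM hE
  have he0 : 0 ≤ e := he.le
  -- (1) the legs-mass
  have hMb := legsMass_le_B hL hbN hCN hCN' hCN'' k he0 he1 hGA hSA M N hM0 hN hM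
  -- (2) the sources
  have hsrc := legsSource_le_B hL1 hpM haG hpN hCN' hCN'' hm20 hGA hSA M G N a hMnn hNnn hann ha hG hN hMb
  -- (3) propagate the legs
  have hEk := rec_two_rates_le_upto hq0 hgapE1 hgapE2 (by positivity) (by positivity) k E (fun l => pM * a l ^ 2 * M l + aG * G l + pN * a l ^ 2 * N l) hE0
    (fun l hl => by have := hE l hl; linarith) hsrc k le_rfl
  -- (4) read the two slots at the top
  exact hEk.trans (top_read_B hL0 he0 he1 hGA hSA haG hCG' hpM hpN hCN hCN' hCN'' hm10 hm20 hgap1 hgap2 k)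

end Summit.QuantumFields.YangMills.Theorems.Prop7RLegsCovScalarB

end
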